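import Summits.BirchSwinnertonDyer.BirchSwinnertonDyer.Theorems.GenusKolyvaginAtTwoMinimalTwinBSDTwoIdentityDoorSha
import Summits.BirchSwinnertonDyer.BirchSwinnertonDyer.Theorems.GenusKolyvaginAtTwoMinimalTwinBSDTwoIdentityDoorCellsAllImages
import HarnessLib

/-!
# Route `GenusKolyvaginAtTwo`, crux U₂ `MinimalTwinBSDTwo` (stmt-BirchSwinnertonDyer-22985), LINE 23 «twin_swap»: THE IDENTITY-LOCUS CELL ENGINE
# WITH AN EXP-SHAPED STUB — `KEX_id` ↦ `EXP_id` «`2^{ord₂ c + ord₂ C(W) + 1} ∥ P(1)`», the `Ш`-factor being the THEOREM `#Ш(W_K)[2^∞] = 4`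

Seat `bsd-line-gk2-p3` g33 (PROVER seat 3/3, cell `bsd-f1-sign2`), sequel of `…IdentityDoorSha` (p783059); `--supports stmt-BirchSwinnertonDyer-22985`
(helper; closes nothing).  THEOREMS ONLY (no definition, no named fact, no `sorry`); standard axioms.  **BSD is NOT proved by this file; U₂ is NOT
proved; nothing is closed.**

* §1 `two_nsmul_eq_zero_of_mem_sha_baseChange_of_shaPrimary_trivial` / `finite_primaryComponent_sha_baseChange_two_of_shaPrimary_trivial` —
  FINITENESS-FREE: for ANY `W/ℚ`, `K` imaginary quadratic, if `Ш(W/ℚ)[2^∞] = 0` and `Ш(W^{(d_K)}/ℚ)[2^∞] = 0` then `Ш(W_K/K)[2^∞]` is killed by `2`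
  (gk2-p4's `OneBit.two_nsmul_mem_map_resBaseChange_of_shaPrimary`: `2x = res(cor x)`, `cor x ∈ Ш(W)[2^∞] = 0`), hence FINITE (inside `Ш(W_K)[2]`).
* §2 `natCard_selmerGroup_baseChange_eq_eight_and_sha_of_identityDoor` — p783059's ★ theorems with the finiteness hypothesis DISCHARGED by §1:
  at an identity-prime door `#Sel₂(W_K) = 8`, `#Ш(W_K)[2] = 4`, `#Ш(W_K)[2^∞] = 4`, UNCONDITIONALLY (no finiteness, no print fact).
* §3 ★ **`bsdp_posDisc_offEgg_of_wall_of_converse_of_idSupply_of_expId_of_facts_allImages`** — gk2-p2 g26's identity-locus engine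
  (`…_of_kex_of_facts_allImages`) with its Kolyvagin-exactness-shaped stub KEX_id REPLACED by the EXP-shaped stub
  **EXP_id: «at every identity-door field with `L(W^{(d_K)},1) ≠ 0` and every conductor-`1` datum, `2^{ord₂ c + ord₂ C(W) + 1} ∥ P(1)`»** — the KEX
  equation `#Ш(W_K)[2^∞] · 4^{ord₂ c + ord₂ C(W)} = 4^{M₀}` is reconstituted with `M₀ = ord₂ c + ord₂ C(W) + 1` from §2.  So LINE 23's three exponent
  stubs (EXP⁻_all, EXP⁺_all, EXP_id) are now of ONE shape «`2^{e} ∥ P(1)`» with `e = ord₂ c + ord₂ C(W)` on `Δ < 0` and on the egg, `e + 1` on the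
  identity locus (the capitulation defect `Ш(W_K)[2] = (ℤ/2)²` of the identity door costs exactly one bit of Heegner depth).
* §4 `twoDivExponent_eq_succ_of_bsdp_of_identityDoor` — LOSSLESSNESS of EXP_id: the BSD pair + PRINT force `M₀ = ord₂ c + ord₂ C(W) + 1` for every exact
  depth `2^{M₀} ∥ P(1)` (gk2-p2's `natCard_sha_mul_eq_of_bsdp` with `#Ш(W_K)[2^∞] = 4`).
* §5 `expId_of_kexId_of_GZK` — the converse substitution KEX_id ⟹ EXP_id (mod GZK): the reshape of §3 is an EQUIVALENCE of stubs.

READING (census, not progress): the BSD₂ content of U₂ on the identity locus is EXACTLY «the Heegner point of an identity-door field is divisible by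
`2^{ord₂ c + ord₂ C(W) + 1}` and not by the next power» — one bit deeper than on `Δ < 0`/egg; everything else on that locus (wall, converse, supply,
`Ш`-count) is print or tree.  BSD is NOT proved; nothing is closed.

References: [Kramer1981] Thm. 1, Prop. 7, Thm. 2; [MazurRubin2010] Lemma 3.2, Prop. 3.3; [GrossZagier1986] V.§2 (2.2); [GrossLMS1991] §5 (5.1)–(5.3);
[Milne1972ArithmeticAV] §1 Thm. 1; [Cassels1962ArithmeticIV] §1; [SerreGaloisCohomology1997] I §2.4 Prop. 9.
-/

set_option linter.dupNamespace false -- tree convention: `Summit.BirchSwinnertonDyer.BirchSwinnertonDyer.Theorems` (summit = sub-problem)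
set_option autoImplicit false

noncomputable section

open scoped Classical

open WeierstrassCurve NumberField IsDedekindDomain Field
open Literature.NumberTheory.EllipticCurves Literature.NumberTheory.EllipticCurves.ModularForms
open Literature.NumberTheory.GaloisRepresentations
open Summit.BirchSwinnertonDyer.Rank1Residual
open Summit.BirchSwinnertonDyer.Rank1Residual.F1Sign2 (selmerGroupRelaxedAtInfinityAtTwo MeetsEgg NoRationalTwoTorsion ShaTwoTrivial)
open Summit.BirchSwinnertonDyer.BirchSwinnertonDyer.Theorems.GenusKolyArch
open Summit.BirchSwinnertonDyer.BirchSwinnertonDyer.Theorems.GenusExact.TwinSwap.IdentityDoor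

namespace Summit.BirchSwinnertonDyer.BirchSwinnertonDyer.Theorems.GenusExact.TwinSwap.IdentityDoorSha

/-! ## §1 `Ш(W_K)[2^∞]` is killed by `2`, hence finite, when both `ℚ`-sides are `2`-primary-trivial -/

section Finite

variable (W : WeierstrassCurve ℚ) [W.IsElliptic] (K : Type) [Field K] [NumberField K]

omit [W.IsElliptic] in
/-- **`2 · Ш(W_K/K)[2^∞] = 0` when `Ш(W/ℚ)[2^∞] = 0` and `Ш(W^{(d_K)}/ℚ)[2^∞] = 0`** (`K` imaginary quadratic, `σ ≠ 1`): by gk2-p4's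
`OneBit.two_nsmul_mem_map_resBaseChange_of_shaPrimary` (`2x = res(cor x)` for `x ∈ Ш(W_K)[2^∞]`, the twin side killing `x − σx`) and
`ShaCores.corBaseChange_mem_sha` (`cor x ∈ Ш(W/ℚ)`, of `2`-power order, hence in `Ш(W)[2^∞] = 0`).  FINITENESS-FREE.
[cite: Kramer1981, Thm. 1] [cite: SerreGaloisCohomology1997, I §2.4 Prop. 9] [cite: GrossLMS1991, §5 (5.1)] -/
theorem two_nsmul_eq_zero_of_mem_sha_baseChange_of_shaPrimary_trivial (hIQ : IsImaginaryQuadratic K) {σ : K ≃ₐ[ℚ] K} (hσ1 : σ ≠ 1)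
    (hW0 : ∀ x ∈ AddCommGroup.primaryComponent (↥W.sha) 2, x = 0)
    (hT0 : ∀ x ∈ AddCommGroup.primaryComponent (↥(W.quadraticTwist (NumberField.discr K : ℚ)).sha) 2, x = 0)
    (x : (W.baseChange K).galH1) (hx : x ∈ (W.baseChange K).sha) (hk : ∃ k : ℕ, 2 ^ k • x = 0) : 2 • x = 0 := by
  have hmem := PlusDescent.OneBit.two_nsmul_mem_map_resBaseChange_of_shaPrimary W K hIQ hσ1 hT0
    (fun c hc ↦ ShaCores.corBaseChange_mem_sha K (W.quadraticTwist (NumberField.discr K : ℚ)) hIQ.1 hσ1 c hc)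
    (fun c hc ↦ ShaCores.corBaseChange_mem_sha K W hIQ.1 hσ1 c hc) x hx hk
  obtain ⟨y, hy, hyx⟩ := AddSubgroup.mem_map.mp hmem
  obtain ⟨z, hz, rfl⟩ := AddSubgroup.mem_map.mp hy
  rw [← hyx, hW0 z hz]
  simp

/-- **`Ш(W_K/K)[2^∞] ⊆ Ш(W_K/K)[2]`, hence `Ш(W_K/K)[2^∞]` is FINITE, when `Ш(W/ℚ)[2^∞] = 0 = Ш(W^{(d_K)}/ℚ)[2^∞]`** (`K` imaginary quadratic):
§1's `2x = 0` and the finiteness of `Ш(W_K) ∩ H¹(K, W)[2]` (a quotient of the finite `Sel₂(W_K)`).  No print fact, no analytic input.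
[cite: Kramer1981, Thm. 1] [cite: SilvermanAEC2009, Thm. X.4.2] -/
theorem finite_primaryComponent_sha_baseChange_two_of_shaPrimary_trivial (hIQ : IsImaginaryQuadratic K)
    (hW0 : ∀ x ∈ AddCommGroup.primaryComponent (↥W.sha) 2, x = 0)
    (hT0 : ∀ x ∈ AddCommGroup.primaryComponent (↥(W.quadraticTwist (NumberField.discr K : ℚ)).sha) 2, x = 0) :
    Finite (AddCommGroup.primaryComponent (↥(W.baseChange K).sha) 2) := by
  haveI : (W.baseChange K).IsElliptic := inferInstanceAs ((W.map (algebraMap ℚ K)).IsElliptic)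
  have h2 : Module.finrank ℚ K = 2 := hIQ.1
  obtain ⟨σ, -, hσ1, -⟩ := PlusDescent.exists_gal_ne_one_sqrt_discr K h2
  set S : AddSubgroup (W.baseChange K).galH1 :=
    (W.baseChange K).sha ⊓ AddSubgroup.torsionBy (W.baseChange K).galH1 ((2 : ℕ) : ℕ) with hS
  haveI : Finite S := by
    have hfin : Finite ((W.baseChange K).selmerGroup ((2 : ℕ) : ℤ)) := finite_selmerGroup_holds (W.baseChange K) (by norm_num)
    have h := card_selmerGroup_eq_pow_rank_mul (W.baseChange K) 2
    apply Nat.finite_of_card_ne_zero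
    intro h0
    rw [h0, mul_zero] at h
    exact (Nat.card_pos (α := (W.baseChange K).selmerGroup ((2 : ℕ) : ℤ))).ne' h
  refine Finite.of_injective (fun x : AddCommGroup.primaryComponent (↥(W.baseChange K).sha) 2 ↦
    (⟨((x : ↥(W.baseChange K).sha) : (W.baseChange K).galH1), AddSubgroup.mem_inf.mpr ⟨(x : ↥(W.baseChange K).sha).2,
      AddSubgroup.torsionBy.nsmul_iff.mpr ?_⟩⟩ : S)) fun x y h ↦ ?_
  · obtain ⟨k, hk⟩ := (AddCommGroup.mem_primaryComponent).mp x.2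
    refine two_nsmul_eq_zero_of_mem_sha_baseChange_of_shaPrimary_trivial W K hIQ hσ1 hW0 hT0 _ (x : ↥(W.baseChange K).sha).2 ⟨k, ?_⟩
    have h' := congrArg (fun z : ↥(W.baseChange K).sha ↦ (z : (W.baseChange K).galH1)) hk
    simpa using h'
  · apply Subtype.ext
    apply Subtype.ext
    simpa using congrArg (fun z : S ↦ (z : (W.baseChange K).galH1)) h

end Finite

/-! ## §2 The identity-prime door counts, finiteness discharged -/

section Counts

variable (W : WeierstrassCurve ℚ) [W.IsElliptic] [W.IsGloballyMinimal] (K : Type) [Field K] [NumberField K]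

/-- **`#Sel₂(W_K/K) = 8`, `#Ш(W_K/K)[2] = 4` and `#Ш(W_K/K)[2^∞] = 4` at an identity-prime door — NO finiteness hypothesis.**  Frame as in
`natCard_selmerGroup_baseChange_eq_eight_and_sha_two_eq_four_of_identityDoor` (p783059): `Δ_W > 0`, rank `1`, `#Sel₂(W) = 2`, `¬ MeetsEgg`; `K`
imaginary quadratic, `d_K = −ℓ` odd, Heegner, `2` split; `ℓ` identity prime with `loc_ℓ` injective on `Sel₂^{rel ∞}(W)`.  The finiteness of
`Ш(W_K)[2^∞]` is §1 (`Ш(W)[2^∞] = 0` from `#Sel₂(W) = 2` and rank `1`; the twin is `2`-Selmer-trivial by gk2-p2's door).  UNCONDITIONAL.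
[cite: Kramer1981, Thm. 1, Thm. 2] [cite: MazurRubin2010, Lemma 3.2, Prop. 3.3] [cite: Cassels1962ArithmeticIV, §1] -/
theorem natCard_selmerGroup_baseChange_eq_eight_and_sha_of_identityDoor (hΔ : 0 < W.Δ)
    (hrk : W.mordellWeilRank = 1) (hSel : Nat.card (W.selmerGroup 2) = 2) (hegg : ¬ MeetsEgg W)
    (hK : IsImaginaryQuadratic K) (hodd : Odd (discr K)) (hH : SatisfiesHeegnerHypothesis (W.conductorNorm ℤ) K)
    (h2K : ((Ideal.span {(2 : ℤ)}).primesOver (𝓞 K)).ncard = 2)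
    {ℓ : ℕ} [Fact ℓ.Prime] (hd : discr K = -(ℓ : ℤ))
    (hid : Nat.card {Q : (W.baseChange ℚ_[ℓ]).toAffine.Point // 2 • Q = 0} = 4)
    (hinj : ∀ c ∈ selmerGroupRelaxedAtInfinityAtTwo W, c ∈ MazurRubin2010.strictLocalKer W ℚ_[ℓ] 2 → c = 0) :
    Nat.card ((W.baseChange K).selmerGroup ((2 : ℕ) : ℤ)) = 8 ∧
      Nat.card ((W.baseChange K).sha ⊓ AddSubgroup.torsionBy (W.baseChange K).galH1 ((2 : ℕ) : ℕ) : AddSubgroup _) = 4 ∧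
      Finite (AddCommGroup.primaryComponent (↥(W.baseChange K).sha) 2) ∧
      Nat.card (AddCommGroup.primaryComponent (↥(W.baseChange K).sha) 2) = 4 := by
  haveI : Fact (Nat.Prime 2) := ⟨Nat.prime_two⟩
  have hdQ0 : (discr K : ℚ) ≠ 0 := by exact_mod_cast NumberField.discr_ne_zero K
  haveI hTell : (W.quadraticTwist (discr K : ℚ)).IsElliptic := W.isElliptic_quadraticTwist hdQ0
  -- `Ш(W)[2^∞] = 0`, and the twin's, by the door
  obtain ⟨-, -, hW0⟩ := rank_eq_one_and_sha_primary_eq_zero_of_natCard_selmerGroup_eq_two W hSel (le_of_eq hrk.symm)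
  have hT : NoRationalTwoTorsion W := EggAllImages.noRationalTwoTorsion_of_natCard_selmerGroup_eq_two W hSel (le_of_eq hrk.symm)
  have hSha : ShaTwoTrivial W := Egg.shaTwoTrivial_of_natCard_selmerGroup_eq_two W hSel (le_of_eq hrk.symm)
  have hstr := forall_mem_selmerGroup_localization_inl_eq_zero_of_not_meetsEgg W hΔ hT hSha hegg
  have hSel1 : Nat.card ((W.quadraticTwist (discr K : ℚ)).selmerGroup 2) = 1 :=
    natCard_selmerGroup_twin_eq_one_of_identityDoor W hΔ hSel hK hodd hH h2K hd hid hstr hinj (W.quadraticTwist (discr K : ℚ))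
      ⟨1, one_smul _ _⟩
  have hSel1' : Nat.card ((W.quadraticTwist (discr K : ℚ)).selmerGroup ((2 : ℕ) : ℤ)) = 1 := by
    rw [Nat.cast_ofNat]; exact hSel1
  have hT0 : ∀ x ∈ AddCommGroup.primaryComponent (↥(W.quadraticTwist (discr K : ℚ)).sha) 2, x = 0 := by
    intro x hx
    rwa [primaryComponent_sha_eq_bot_of_natCard_selmerGroup_eq_one (W.quadraticTwist (discr K : ℚ)) 2 hSel1', AddSubgroup.mem_bot] at hx
  haveI hfin : Finite (AddCommGroup.primaryComponent (↥(W.baseChange K).sha) 2) :=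
    finite_primaryComponent_sha_baseChange_two_of_shaPrimary_trivial W K hK hW0 hT0
  obtain ⟨h8, h4⟩ := natCard_selmerGroup_baseChange_eq_eight_and_sha_two_eq_four_of_identityDoor W K hΔ hrk hSel hegg hK hodd hH h2K hd
    hid hinj
  exact ⟨h8, h4, hfin, natCard_primaryComponent_sha_baseChange_two_eq_four_of_identityDoor W K hΔ hrk hSel hegg hK hodd hH h2K hd hid hinj⟩

end Counts

/-! ## §3 The identity-locus cell engine with the EXP-shaped stub EXP_id -/

section Cells

open Summit.BirchSwinnertonDyer.BirchSwinnertonDyer.Theorems.GenusExact.TwinSwap.Ledger.Line25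
  (entireLFunction_twist_one_ne_zero_of_rankZeroTwoConverse_of_natCard_selmerGroup_eq_one
    exists_kolyvaginHeegnerData_one_of_nonempty_modularParametrizationData not_isOfFinAddOrder_derivedPoint_one_of_rankOne_of_lValue_ne_zero)

/-- ★ **U₂ ON THE WHOLE `Δ > 0` OFF-EGG LOCUS — wall + rank-zero 2-converse + identity-door supply + the EXP-SHAPED exponent EXP_id.**
gk2-p2 g26's engine `bsdp_posDisc_offEgg_of_wall_of_converse_of_idSupply_of_kex_of_facts_allImages` with the same PRINT facts (`hGZ`, `hGZK`, `hmod`,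
`hMilneC`, `hMP`), S1 (`hS1`), CONV₀ (`hC0`) and IDENTITY-DOOR SUPPLY (`hIDS`, a theorem mod GZK), but with the Kolyvagin-exactness-shaped stub KEX_id
(«SOME exact depth `M₀` with `#Ш(W_K)[2^∞] · 4^{ord₂ c + ord₂ C(W)} = 4^{M₀}`») REPLACED by **EXP_id**: «for `W` non-CM, `r_an = 1`, `#Sel₂ = 2`, `Δ > 0`,
`¬ MeetsEgg`, at every identity-door field `K = ℚ(√−ℓ)` (identity prime `ℓ`, `loc_ℓ` injective on `Sel₂^{rel ∞}(W)`, `d_K` odd `≠ −3`, Heegner, `2`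
split) with `L(W^{(d_K)},1) ≠ 0` and every conductor-`1` datum, **`2^{ord₂ c + ord₂ C(W) + 1} ∥ P(1)`**».  The KEX equation is reconstituted with
`M₀ = ord₂ c + ord₂ C(W) + 1`, its `Ш`-factor being the THEOREM `#Ш(W_K)[2^∞] = 4` (§2; rank `1` from GZK).  CONCLUSION: `BSD₂(W)` for every non-CM
globally minimal `W` with `r_an = 1`, `#Sel₂ = 2`, `Δ > 0`, `W(ℚ) ⊂ W⁰(ℝ)`.  CONDITIONAL on the displayed hypotheses; proves nothing about BSD; closes nothing.
[cite: Kramer1981, Thm. 1, Thm. 2] [cite: MazurRubin2010, Lemmas 2.9–2.11, Prop. 3.3] [cite: GrossZagier1986, V.§2 (2.2)] [cite: Milne1972ArithmeticAV, §1 Thm. 1]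
[cite: Miller2011LMS, Def. 1.1] -/
theorem bsdp_posDisc_offEgg_of_wall_of_converse_of_idSupply_of_expId_of_facts_allImages
    (hGZ : ∀ (N : ℕ) [NeZero N] (W : WeierstrassCurve ℚ) (K : Type) [Field K] [NumberField K], gross_zagier N W K)
    (hGZK : rank_eq_analyticRank_of_analyticRank_le_one) (hmod : hasEntireLFunction_rat)
    (hMilneC : Milne1972.bsdQuotient_baseChange_quadratic_anyModel) (hMP : nonempty_modularParametrizationData)
    (hS1 : ∀ (W : WeierstrassCurve ℚ) [W.IsElliptic] [W.IsGloballyMinimal],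
      ¬ W.HasCM → W.analyticRank = 0 → Nat.card (W.selmerGroup 2) = 1 → BSDp W 2)
    (hC0 : ∀ (V : WeierstrassCurve ℚ) [V.IsElliptic] [V.IsGloballyMinimal], ¬ V.HasCM → V.selmerCorank 2 = 0 → V.analyticRank = 0)
    (hIDS : ∀ (W : WeierstrassCurve ℚ) [W.IsElliptic] [W.IsGloballyMinimal] [NeZero (W.conductorNorm ℤ)],
      ¬ W.HasCM → W.analyticRank = 1 → Nat.card (W.selmerGroup 2) = 2 → 0 < W.Δ → ¬ MeetsEgg W →
      ∃ (K : Type) (_ : Field K) (_ : NumberField K) (ℓ : ℕ) (_ : Fact ℓ.Prime),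
        IsImaginaryQuadratic K ∧ NumberField.discr K = -(ℓ : ℤ) ∧
        Nat.card {Q : (W.baseChange ℚ_[ℓ]).toAffine.Point // 2 • Q = 0} = 4 ∧
        (∀ c ∈ selmerGroupRelaxedAtInfinityAtTwo W, c ∈ MazurRubin2010.strictLocalKer W ℚ_[ℓ] 2 → c = 0) ∧
        Odd (NumberField.discr K) ∧ NumberField.discr K ≠ -3 ∧ SatisfiesHeegnerHypothesis (W.conductorNorm ℤ) K ∧
        ((Ideal.span {(2 : ℤ)}).primesOver (𝓞 K)).ncard = 2 ∧
        ∃ (Wd : WeierstrassCurve ℚ) (_ : Wd.IsElliptic) (_ : Wd.IsGloballyMinimal),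
          ∃ C : VariableChange ℚ, C • W.quadraticTwist (NumberField.discr K : ℚ) = Wd)
    (hEXP : ∀ (W : WeierstrassCurve ℚ) [W.IsElliptic] [W.IsGloballyMinimal] [NeZero (W.conductorNorm ℤ)],
      ¬ W.HasCM → W.analyticRank = 1 → Nat.card (W.selmerGroup 2) = 2 → 0 < W.Δ → ¬ MeetsEgg W →
      ∀ (K : Type) [Field K] [NumberField K], IsImaginaryQuadratic K →
        ∀ (ℓ : ℕ) [Fact ℓ.Prime], NumberField.discr K = -(ℓ : ℤ) →
        Nat.card {Q : (W.baseChange ℚ_[ℓ]).toAffine.Point // 2 • Q = 0} = 4 →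
        (∀ c ∈ selmerGroupRelaxedAtInfinityAtTwo W, c ∈ MazurRubin2010.strictLocalKer W ℚ_[ℓ] 2 → c = 0) →
        Odd (NumberField.discr K) → NumberField.discr K ≠ -3 → SatisfiesHeegnerHypothesis (W.conductorNorm ℤ) K →
        ((Ideal.span {(2 : ℤ)}).primesOver (𝓞 K)).ncard = 2 →
        (W.quadraticTwist (NumberField.discr K : ℚ)).entireLFunction 1 ≠ 0 →
        ∀ (Dt : ModularParametrizationData W (W.conductorNorm ℤ)) (β : ℤ) (ι : K →+* ℂ) (d₁ : KolyvaginHeegnerData Dt β ι 1),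
          (∃ Q : (W.baseChange (ringClassField K ι 1)).toAffine.Point,
            ((2 ^ (padicValInt 2 Dt.c + padicValNat 2 W.tamagawaProduct + 1) : ℕ) : ℤ) • Q = d₁.derivedPoint) ∧
          (¬ ∃ Q : (W.baseChange (ringClassField K ι 1)).toAffine.Point,
            ((2 ^ (padicValInt 2 Dt.c + padicValNat 2 W.tamagawaProduct + 1 + 1) : ℕ) : ℤ) • Q = d₁.derivedPoint)) :
    ∀ (W : WeierstrassCurve ℚ) [W.IsElliptic] [W.IsGloballyMinimal], ¬ W.HasCM → W.analyticRank = 1 →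
      Nat.card (W.selmerGroup 2) = 2 → 0 < W.Δ → ¬ MeetsEgg W → BSDp W 2 := by
  refine bsdp_posDisc_offEgg_of_wall_of_converse_of_idSupply_of_kex_of_facts_allImages hGZ hGZK hmod hMilneC hMP hS1 hC0 hIDS ?_
  intro W _ _ _ hcm hr hSel hΔ hegg K _ _ hK ℓ _ hd hid hinj hodd h3 hH h2K hL Dt β ι d₁
  obtain ⟨hdiv, hndiv⟩ := hEXP W hcm hr hSel hΔ hegg K hK ℓ hd hid hinj hodd h3 hH h2K hL Dt β ι d₁
  refine ⟨padicValInt 2 Dt.c + padicValNat 2 W.tamagawaProduct + 1, hdiv, hndiv, ?_⟩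
  -- rank one (GZK) and the `Ш`-count of §2
  have hrk : W.mordellWeilRank = 1 := by rw [(hGZK W (le_of_eq hr)).1, hr]
  obtain ⟨-, -, -, h4⟩ := natCard_selmerGroup_baseChange_eq_eight_and_sha_of_identityDoor W K hΔ hrk hSel hegg hK hodd hH h2K hd hid hinj
  rw [h4]
  ring

end Cells

/-! ## §4 Losslessness of EXP_id: the BSD pair forces the depth `ord₂ c + ord₂ C(W) + 1` -/

section Lossless

variable (W : WeierstrassCurve ℚ) [W.IsElliptic] [W.IsGloballyMinimal] [NeZero (W.conductorNorm ℤ)]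
  (K : Type) [Field K] [NumberField K]

/-- **LOSSLESSNESS of EXP_id.**  On an identity-prime door frame (`r_an(W) = 1`, `#Sel₂(W) = 2`, `Δ > 0`, `¬ MeetsEgg`; `K` imaginary quadratic,
`d_K = −ℓ` odd `≠ −3`, Heegner, `2` split; `ℓ` identity prime with `loc_ℓ` injective on `Sel₂^{rel ∞}(W)`), a datum `Dt` (`c ≠ 0`), `d₁` of conductor
`1` with `P(1)` of infinite order and ANY exact depth `2^{M₀} ∥ P(1)`, a globally minimal model `Wd` of `W^{(d_K)}`: **`BSD₂(W) ∧ BSD₂(Wd)` + PRINT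
force `M₀ = ord₂ c + ord₂ C(W) + 1`.**  gk2-p2's `natCard_sha_mul_eq_of_bsdp` gives `#Ш(W_K)[2^∞] · 4^{ord₂ c + ord₂ C(W)} = 4^{M₀}`; §2 gives
`#Ш(W_K)[2^∞] = 4` (rank `1` from GZK; `#Sel₂(Wd) = 1` by the door).  So EXP_id carries NO slack.  CONDITIONAL on the two `BSD₂` and the four named
facts; nothing about BSD is proved.  [cite: GrossZagier1986, V.§2 (2.2)] [cite: Milne1972ArithmeticAV, §1 Thm. 1] [cite: Kramer1981, Thm. 1, Thm. 2] -/
theorem twoDivExponent_eq_succ_of_bsdp_of_identityDoor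
    (hGZ : gross_zagier (W.conductorNorm ℤ) W K) (hGZK : rank_eq_analyticRank_of_analyticRank_le_one)
    (hmod : hasEntireLFunction_rat) (hMilneC : Milne1972.bsdQuotient_baseChange_quadratic_anyModel)
    (hr : W.analyticRank = 1) (hSel : Nat.card (W.selmerGroup 2) = 2) (hΔ : 0 < W.Δ) (hegg : ¬ MeetsEgg W)
    (hK : IsImaginaryQuadratic K) (hodd : Odd (NumberField.discr K)) (h3 : NumberField.discr K ≠ -3)
    (hH : SatisfiesHeegnerHypothesis (W.conductorNorm ℤ) K) (h2K : ((Ideal.span {(2 : ℤ)}).primesOver (𝓞 K)).ncard = 2)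
    {ℓ : ℕ} [Fact ℓ.Prime] (hd : discr K = -(ℓ : ℤ))
    (hid : Nat.card {Q : (W.baseChange ℚ_[ℓ]).toAffine.Point // 2 • Q = 0} = 4)
    (hinj : ∀ c ∈ selmerGroupRelaxedAtInfinityAtTwo W, c ∈ MazurRubin2010.strictLocalKer W ℚ_[ℓ] 2 → c = 0)
    (Dt : ModularParametrizationData W (W.conductorNorm ℤ)) (hc0 : Dt.c ≠ 0) (β : ℤ) (ι : K →+* ℂ)
    (d₁ : KolyvaginHeegnerData Dt β ι 1) (hy : ¬ IsOfFinAddOrder d₁.derivedPoint) {M₀ : ℕ}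
    (hdiv : ∃ Q : (W.baseChange (ringClassField K ι 1)).toAffine.Point, ((2 ^ M₀ : ℕ) : ℤ) • Q = d₁.derivedPoint)
    (hndiv : ¬ ∃ Q : (W.baseChange (ringClassField K ι 1)).toAffine.Point, ((2 ^ (M₀ + 1) : ℕ) : ℤ) • Q = d₁.derivedPoint)
    (Wd : WeierstrassCurve ℚ) [Wd.IsElliptic] [Wd.IsGloballyMinimal]
    (hWd : ∃ C : VariableChange ℚ, C • W.quadraticTwist (NumberField.discr K : ℚ) = Wd)
    (hBW : BSDp W 2) (hBd : BSDp Wd 2) :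
    M₀ = padicValInt 2 Dt.c + padicValNat 2 W.tamagawaProduct + 1 := by
  -- rank one (GZK), the door twin is `2`-Selmer-trivial, the `Ш`-count
  have hrk : W.mordellWeilRank = 1 := by rw [(hGZK W (le_of_eq hr)).1, hr]
  have hT : NoRationalTwoTorsion W := EggAllImages.noRationalTwoTorsion_of_natCard_selmerGroup_eq_two W hSel (le_of_eq hrk.symm)
  have hSha : ShaTwoTrivial W := Egg.shaTwoTrivial_of_natCard_selmerGroup_eq_two W hSel (le_of_eq hrk.symm)
  have hstr := forall_mem_selmerGroup_localization_inl_eq_zero_of_not_meetsEgg W hΔ hT hSha hegg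
  have hSel1 : Nat.card (Wd.selmerGroup 2) = 1 := natCard_selmerGroup_twin_eq_one_of_identityDoor W hΔ hSel hK hodd hH h2K hd hid hstr hinj Wd hWd
  obtain ⟨-, -, -, h4⟩ := natCard_selmerGroup_baseChange_eq_eight_and_sha_of_identityDoor W K hΔ hrk hSel hegg hK hodd hH h2K hd hid hinj
  have h := natCard_sha_mul_eq_of_bsdp W K hGZ hGZK hmod hMilneC hr hSel hK hodd h3 hH Dt hc0 β ι d₁ hy hdiv hndiv Wd hWd hSel1 hBW hBd
  rw [h4] at h
  -- `4 · 2^{2e} = 2^{2 M₀}` forces `M₀ = e + 1`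
  have h' : 2 ^ (2 * (padicValInt 2 Dt.c + padicValNat 2 W.tamagawaProduct + 1)) = 2 ^ (2 * M₀) := by
    rw [← h]; ring
  have hinj2 := Nat.pow_right_injective (le_refl 2) h'
  omega

end Lossless

/-! ## §5 KEX_id ⟹ EXP_id: the two stub shapes are EQUIVALENT on the identity locus -/

section Equivalence

/-- **KEX_id ⟹ EXP_id** (the converse of the substitution made in §3), modulo GZK only (rank `1` from `r_an = 1`): if at an identity-door frame SOME
exact depth `2^{M₀} ∥ P(1)` satisfies `#Ш(W_K)[2^∞] · 4^{ord₂ c + ord₂ C(W)} = 4^{M₀}` (the v2.0/v2.1 stub KEX_id, binders VERBATIM), then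
`M₀ = ord₂ c + ord₂ C(W) + 1` because `#Ш(W_K)[2^∞] = 4` (§2), i.e. **`2^{ord₂ c + ord₂ C(W) + 1} ∥ P(1)`** (the v2.2 stub EXP_id, binders VERBATIM).
With §3 this makes the reshape KEX_id ↦ EXP_id an EQUIVALENCE of stubs (given GZK, a conjunct of PRINT).  Nothing about BSD is proved.
[cite: Kramer1981, Thm. 1, Thm. 2] [cite: GrossZagier1986, V.§2 (2.2)] -/
theorem expId_of_kexId_of_GZK (hGZK : rank_eq_analyticRank_of_analyticRank_le_one)
    (hKEX : ∀ (W : WeierstrassCurve ℚ) [W.IsElliptic] [W.IsGloballyMinimal] [NeZero (W.conductorNorm ℤ)],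
      ¬ W.HasCM → W.analyticRank = 1 → Nat.card (W.selmerGroup 2) = 2 → 0 < W.Δ → ¬ MeetsEgg W →
      ∀ (K : Type) [Field K] [NumberField K], IsImaginaryQuadratic K →
        ∀ (ℓ : ℕ) [Fact ℓ.Prime], NumberField.discr K = -(ℓ : ℤ) →
        Nat.card {Q : (W.baseChange ℚ_[ℓ]).toAffine.Point // 2 • Q = 0} = 4 →
        (∀ c ∈ selmerGroupRelaxedAtInfinityAtTwo W, c ∈ MazurRubin2010.strictLocalKer W ℚ_[ℓ] 2 → c = 0) →
        Odd (NumberField.discr K) → NumberField.discr K ≠ -3 → SatisfiesHeegnerHypothesis (W.conductorNorm ℤ) K →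
        ((Ideal.span {(2 : ℤ)}).primesOver (𝓞 K)).ncard = 2 →
        (W.quadraticTwist (NumberField.discr K : ℚ)).entireLFunction 1 ≠ 0 →
        ∀ (Dt : ModularParametrizationData W (W.conductorNorm ℤ)) (β : ℤ) (ι : K →+* ℂ) (d₁ : KolyvaginHeegnerData Dt β ι 1),
          ∃ M₀ : ℕ,
            (∃ Q : (W.baseChange (ringClassField K ι 1)).toAffine.Point, ((2 ^ M₀ : ℕ) : ℤ) • Q = d₁.derivedPoint) ∧
            (¬ ∃ Q : (W.baseChange (ringClassField K ι 1)).toAffine.Point, ((2 ^ (M₀ + 1) : ℕ) : ℤ) • Q = d₁.derivedPoint) ∧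
            Nat.card (AddCommGroup.primaryComponent (W.baseChange K).sha 2) *
                2 ^ (2 * (padicValInt 2 Dt.c + padicValNat 2 W.tamagawaProduct)) = 2 ^ (2 * M₀)) :
    ∀ (W : WeierstrassCurve ℚ) [W.IsElliptic] [W.IsGloballyMinimal] [NeZero (W.conductorNorm ℤ)],
      ¬ W.HasCM → W.analyticRank = 1 → Nat.card (W.selmerGroup 2) = 2 → 0 < W.Δ → ¬ MeetsEgg W →
      ∀ (K : Type) [Field K] [NumberField K], IsImaginaryQuadratic K →
        ∀ (ℓ : ℕ) [Fact ℓ.Prime], NumberField.discr K = -(ℓ : ℤ) →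
        Nat.card {Q : (W.baseChange ℚ_[ℓ]).toAffine.Point // 2 • Q = 0} = 4 →
        (∀ c ∈ selmerGroupRelaxedAtInfinityAtTwo W, c ∈ MazurRubin2010.strictLocalKer W ℚ_[ℓ] 2 → c = 0) →
        Odd (NumberField.discr K) → NumberField.discr K ≠ -3 → SatisfiesHeegnerHypothesis (W.conductorNorm ℤ) K →
        ((Ideal.span {(2 : ℤ)}).primesOver (𝓞 K)).ncard = 2 →
        (W.quadraticTwist (NumberField.discr K : ℚ)).entireLFunction 1 ≠ 0 →
        ∀ (Dt : ModularParametrizationData W (W.conductorNorm ℤ)) (β : ℤ) (ι : K →+* ℂ) (d₁ : KolyvaginHeegnerData Dt β ι 1),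
          (∃ Q : (W.baseChange (ringClassField K ι 1)).toAffine.Point,
            ((2 ^ (padicValInt 2 Dt.c + padicValNat 2 W.tamagawaProduct + 1) : ℕ) : ℤ) • Q = d₁.derivedPoint) ∧
          (¬ ∃ Q : (W.baseChange (ringClassField K ι 1)).toAffine.Point,
            ((2 ^ (padicValInt 2 Dt.c + padicValNat 2 W.tamagawaProduct + 1 + 1) : ℕ) : ℤ) • Q = d₁.derivedPoint) := by
  intro W _ _ _ hcm hr hSel hΔ hegg K _ _ hK ℓ _ hd hid hinj hodd h3 hH h2K hL Dt β ι d₁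
  obtain ⟨M₀, hdiv, hndiv, hsha⟩ := hKEX W hcm hr hSel hΔ hegg K hK ℓ hd hid hinj hodd h3 hH h2K hL Dt β ι d₁
  have hrk : W.mordellWeilRank = 1 := by rw [(hGZK W (le_of_eq hr)).1, hr]
  obtain ⟨-, -, -, h4⟩ := natCard_selmerGroup_baseChange_eq_eight_and_sha_of_identityDoor W K hΔ hrk hSel hegg hK hodd hH h2K hd hid hinj
  rw [h4] at hsha
  -- `4 · 2^{2e} = 2^{2 M₀}` forces `M₀ = e + 1`
  have h' : 2 ^ (2 * (padicValInt 2 Dt.c + padicValNat 2 W.tamagawaProduct + 1)) = 2 ^ (2 * M₀) := by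
    rw [← hsha]; ring
  have hM₀ : M₀ = padicValInt 2 Dt.c + padicValNat 2 W.tamagawaProduct + 1 := by
    have hinj2 := Nat.pow_right_injective (le_refl 2) h'
    omega
  subst hM₀
  exact ⟨hdiv, hndiv⟩

end Equivalence

end Summit.BirchSwinnertonDyer.BirchSwinnertonDyer.Theorems.GenusExact.TwinSwap.IdentityDoorSha

end
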